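import Summits.ABC.ABC.Theses.YuMatveevShapeRat
import Summits.ABC.StewartYu.GenThreeFrameSpecArchW
import Summits.ABC.StewartYu.ArchG3LineSupplyS
import Summits.ABC.StewartYu.ArchG3StartSupplyS
import Summits.ABC.StewartYu.ArchG3RecordW
import Summits.ABC.StewartYu.ArchG3RecLinesAll
import Literature.NumberTheory.Transcendental.Nesterenko2003Prop51Holds
import HarnessLib

set_option linter.dupNamespace false

/-! # Line skeleton v5 — FINAL, SORRY-FREE (every stub discharged by tree theorems; last stub ✓ `ArchG3Line.linesSupplyS_far`, p583746) — for crux `ArchCoreRat` (stmt-ABC-20502, route YuMatveevShapeRat, rung A1.L) — line `arch-g3-frame`,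
SIX-stub shape on the SUPPLY predicates of `Summits/ABC/StewartYu/ArchG3LineSupply(S).lean` (plan g12 RULINGS R42/R43/R45/R47; registrar p4 g10)

ONE-STAGE, Θ′-from-the-start: for every REDUCED pivot-weighted datum `(a, b, A, B, k₀)` under the negated bound at the constant `c`, the
frame runs on a SATURATED basis `θ` (`S(θ) := setupOf n θ _ b̃ j̃₀ _`, saturation datum `F : S.SatData` over the original `(a, b)`), on the
letters of p1's record `P : ArchG3Rec n` (`P.A = A`, `P.W = log(eB)`, `P.N = F.N`) — on a SHAPED basis (lower-triangular Hermite-reduced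
`U`, `0 ≤ U ≤ N`, `|C| ≤ (n−1)!·N`, pivot = last index = maximal weight: R47, p5 g9's finding) — through lp-1's D-generic schedule with the virtual
boxes `LνR P` and p5's packs from letter lines, to the END at the real roots `ξ = a^{1/N}` and the pivot-weighted Kummer-free induction.
The stubs are the SUPPLIES (texts = the tree predicates, each upward-closed in `c` per R43):

* `Sig.stub_satStartArch` (p4 per R46): `∃ c₀, ∀ c ≥ c₀, ArchG3Line.StartSupplyS c` — DISCHARGED by `ArchG3Line.startSupplyS_stub`
  (`ArchG3StartSupplyS`: p5's lower-triangular kit + lp-1's `archLevelStateQ_zero_closed`);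
* `Sig.stub_recLinesArch`: `∃ c₀, ∀ c ≥ c₀, ArchG3Line.LinesSupplyS c` — DISCHARGED by `ArchG3Line.linesSupplyS_far` (`ArchG3RecLinesAll`, p5; c₀ = 2^68; families p1 (F), p4 K (J)(C), p2 O, p5 H, p3 seams/CS);
* `Sig.stub_packsArch` (p5) — DISCHARGED by `ArchG3Setup.archPacksHoldV_of_linesHoldV` (`ArchG3LinesV`);
* `Sig.stub_recordArch` (p4): `ArchG3Line.RecordSupply` (`∀ n ≥ 2, ∃ Y, ∀ c ≥ 2^100, ∀ P, RecordArchW (c^·) Y n P.A P.D₀ P.S₀ P.X_fin P.D`)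
  — DISCHARGED by `ArchG3Rec.recordSupplyArch` (`ArchG3RecordW`: exits A/B ✓ p1, covolume clause (C) and numerics (N) p4);
* `Sig.stub_endLettersArch` (p4) — DISCHARGED by `ArchG3Line.endLetters_holds` (`ArchG3LineSupply`);
and `ArchCoreRat_of` composes the ONE open stub (`Sig.stub_recLinesArch`) BY NAME with the discharged ones inside, through `ArchG3Line.frameArchW_of_suppliesS` (START → lines → packs →
last level → `EndAt` → frame), `archCoreRat_of_frameW_two_le_pow` at `c := max c₀ˢ (max c₀ᴸ 2^100)` and the zero estimate
`Nesterenko2003_prop51_holds` (kernel-checked, no sorry of its own; no sorried closed form in this file, R39(c)/20:16:59Z). -/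

namespace Summit.ABC.ABC.Cruxes.ArchCoreRat.ArchG3Frame

open Finset
open scoped Matrix
open Summit.ABC.ABC.Theses.YuMatveevShapeRat
open Literature.NumberTheory.Transcendental Literature.NumberTheory.Transcendental.GaGm
open Summit.ABC.StewartYu
open Summit.ABC.StewartYu.GenThreeFrameSpecArchW

/-- STUB STATEMENT (START; owner p4 per R46, kit p1/p5, state lp-1): the shaped START supply at every constant above some floor.
[cite: Nesterenko2003, §3.5, §4 (4.6); shape only] -/
def Sig.stub_satStartArch : Prop := ∃ c₀ : ℝ, ∀ c : ℝ, c₀ ≤ c → ArchG3Line.StartSupplyS c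

/-- STUB STATEMENT (LETTER LINES; owner p5): the letter-lines supply at every constant above some floor.
[cite: Nesterenko2003, §4.2–4.3; shape only] -/
def Sig.stub_recLinesArch : Prop := ∃ c₀ : ℝ, ∀ c : ℝ, c₀ ≤ c → ArchG3Line.LinesSupplyS c

/-- STUB STATEMENT (PACKS; owner p5; discharged): letter lines ⇒ the D-generic packs, for every set-up and every schedule.
[cite: Nesterenko2003, §4 Prop. 4.1; shape only] -/
def Sig.stub_packsArch : Prop :=
  ∀ (S : ArchG3Setup) (F : S.SatData) (H Sh : ℕ) (s : Fin S.n → ℕ) (U : Finset (ℕ × (Fin S.n → ℤ))) (P : ℤ) (δ₀ : ℝ)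
    (wl γb : ℕ → ℝ) (cl : ℕ → ℤ) (el : ℕ → Fin S.n → ℤ) (Bv : ℕ → Fin S.n → ℕ) (N T : ℕ → ℕ → ℕ) (Nh : ℕ → ℕ),
    S.ArchLinesHoldV F H Sh s U P δ₀ wl γb cl el Bv N T Nh → S.ArchPacksHoldV F H Sh s U P δ₀ wl γb cl el Bv N T Nh

/-- STUB STATEMENT (RECORD; owner p4): the record obligations `RecordArchW` at every `P : ArchG3Rec n`, `n ≥ 2`, `c ≥ 2^100`.
[cite: Nesterenko2003, §5.2 (5.13)–(5.22); shape only] -/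
def Sig.stub_recordArch : Prop := ArchG3Line.RecordSupply

/-- STUB STATEMENT (END LETTERS; owner p4; discharged): the END letters of every record. [cite: Nesterenko2003, §5.2 (5.5)–(5.12); shape only] -/
def Sig.stub_endLettersArch : Prop := ArchG3Line.EndLetters

/-- STUB (START) — DISCHARGED by `ArchG3Line.startSupplyS_stub` (✓ `ArchG3StartSupplyS`). -/
theorem stub_satStartArch : Sig.stub_satStartArch := ArchG3Line.startSupplyS_stub

/-- STUB (LETTER LINES — open; p5). -/
theorem stub_recLinesArch : Sig.stub_recLinesArch := ArchG3Line.linesSupplyS_far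

/-- STUB (PACKS) — discharged by p5's `archPacksHoldV_of_linesHoldV`. -/
theorem stub_packsArch : Sig.stub_packsArch :=
  fun S F _ _ _ _ _ _ _ _ _ _ _ _ _ _ h => S.archPacksHoldV_of_linesHoldV F h

/-- STUB (RECORD) — DISCHARGED by `ArchG3Rec.recordSupplyArch` (✓ `ArchG3RecordW`). -/
theorem stub_recordArch : Sig.stub_recordArch := ArchG3Rec.recordSupplyArch

/-- STUB (END LETTERS) — discharged by `ArchG3Line.endLetters_holds`. -/
theorem stub_endLettersArch : Sig.stub_endLettersArch := ArchG3Line.endLetters_holds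

/-- COMPOSITION (hypothesis form): the crux BY NAME from exactly the ONE open stub statement (START, record and END letters discharged inside by
tree theorems, packs inside the glue); kernel-checked, no sorry of its own. -/
theorem ArchCoreRat_of : Sig.stub_recLinesArch → ArchCoreRat := by
  rintro ⟨cL, hL⟩
  obtain ⟨cS, hS⟩ : Sig.stub_satStartArch := stub_satStartArch
  have hR : Sig.stub_recordArch := stub_recordArch
  have hE : Sig.stub_endLettersArch := stub_endLettersArch
  unfold ArchCoreRat
  set c : ℝ := max cS (max cL ((2 : ℝ) ^ 100)) with hc
  have hcS : cS ≤ c := le_max_left _ _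
  have hcL : cL ≤ c := le_trans (le_max_left _ _) (le_max_right _ _)
  have hc100 : (2 : ℝ) ^ 100 ≤ c := le_trans (le_max_right _ _) (le_max_right _ _)
  have hc2 : (2 : ℝ) ≤ c := le_trans (by norm_num) hc100
  refine archCoreRat_of_frameW_two_le_pow hc2 (fun _ n hn => ?_) Nesterenko2003_prop51_holds
  exact ArchG3Line.frameArchW_of_suppliesS (hS c hcS) (hL c hcL)
    (fun m hm => by obtain ⟨Y, hY⟩ := hR m hm; exact ⟨Y, fun P => hY c hc100 P⟩) hE n hn

/-- **THE LINE CLOSED (final, sorry-free)**: the crux from the skeleton's composition and the discharged last stub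
(the filed closer is `Summits/ABC/ABC/Theorems/YuMatveevShapeRatArchCoreRatLine.lean`, `archCoreRat_proof`). -/
theorem ArchCoreRat_line : ArchCoreRat := ArchCoreRat_of stub_recLinesArch

end Summit.ABC.ABC.Cruxes.ArchCoreRat.ArchG3Frame
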